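import Summits.QuantumFields.QCD.Theorems.EulerDescentHonestHeavyAnchorRaySplit
import HarnessLib.Audit

/-!
# Line `bounded-locator` for the crux `HonestHeavyAnchor` (item stmt-QuantumFields-16901) — rev 3 (lead, cycle 1): the RAY split

Route `EulerDescent` (sub-problem QCD), crux decl `Summit.QuantumFields.QCD.Theses.EulerDescent.HonestHeavyAnchor`
(rank 3, open-problem).  Lead `prover-line-stmt-QuantumFields-16901-0`, 2026-08-17.  Earlier revisions kept in the lead's folder
(`work/HonestHeavyAnchor.rev1.lean` = strategist's S1 S2 S3' S4'; `rev2` = S1 B N U S4').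

## The cut (4 stubs; composition = the LANDED glue `HonestHeavyAnchorRaySplit.honestHeavyAnchor_of_threshold_of_branchTransition_of_rays`)

crux ⟸ S1 (threshold anchor, = stmt-8794) ∧ T (branch transition at fixed weak coupling) ∧ U (massive ray above the
construction's heavy trajectory) ∧ R (non-massive point within bounded RGI depth below the construction's critical mass).
The intrinsic corner `mc k := sup NonMassive(β_k)`, both locator bounds `−M' ≤ (m_crit − mc)Z_m/a ≤ C`, and the physical
branch after re-pinning are ASSEMBLED inside the glue by order bookkeeping (non-empty by R, bounded above by U, `mc > −1/2` by T
along `β_k → ∞`), then Bolzano–Weierstrass + `restrict` + re-pin as in rev 1.  Against rev 2 this DROPS the weak-coupling massive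
barrier B (lattice Yang–Mills clustering at EVERY large β — not implied by the crux) and the closing of the corner (`mc → 0`);
S1, U, R are each implied by the crux at its own witness (landed: `HonestHeavyAnchorSplit.thresholdQCD_of_honestHeavyAnchor`,
`HonestHeavyAnchorLowerLocator.massive_rays_of_honestHeavyAnchor`, `HonestHeavyAnchorRaySplit.nonMassive_below_of_honestHeavyAnchor`),
so the line is tight up to the fixed-coupling packaging of T.  All four stubs are open-problem grade; none but S1 has an
existing ledger item (S1 = stmt-QuantumFields-8794, blocked-on).  Standing disprover (Disproof.lean c1): no kill.
-/

noncomputable section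

namespace Summit.QuantumFields.QCD.Cruxes.HonestHeavyAnchor.BoundedLocator

open scoped Topology
open Filter
open Literature.MathematicalPhysics.QuantumFieldTheory
open Summit.QuantumFields.QCD.Theses.EulerDescent (HonestHeavyAnchor)
open Summit.QuantumFields.QCD.Theorems

/-! ## §0 The four stub STATEMENTS as constants (composition hypotheses must be headed by constants whose short name is a
declared stub); the `stub_*` theorems of §1 state the same propositions INLINED (definitionally equal). -/

/-- (S1) statement. -/
def Stmt.stub_heavyThresholdAnchor : Prop :=
    ∀ Nf : ℕ, Nf = 2 ∨ Nf = 3 → ∃ M₀ : ℝ, 0 ≤ M₀ ∧ ∃ reg : QCDRegularisation Nf, reg.HasMassScaling ∧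
    ∀ m : Fin Nf → ℝ, (∀ f, M₀ < m f) → ∃ (z shift : QCDField Nf → ℕ → ℝ) (T : OSData (QCDField Nf) 4),
    IsQCDAlong (reg.scheme m z shift) T ∧ T.IsNontrivial QCDField.glue ∧ T.IsNonGaussian QCDField.glue ∧
    (∀ f g : Fin Nf, f ≠ g → T.IsNontrivial (QCDField.pseudoRe f g)) ∧
    ∃ Δ > 0, T.HasMassGap Δ ∧ (reg.scheme m z shift).HasLatticeMassGap Δ

/-- (T) statement. -/
def Stmt.stub_branchTransition : Prop :=
    ∀ Nf : ℕ, Nf = 2 ∨ Nf = 3 → ∃ β₀ : ℝ, ∀ β : ℝ, β₀ ≤ β → ∃ μ : ℝ, -(1 / 2 : ℝ) < μ ∧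
    ¬ (∀ (R R' : ℕ) (A : QCDLatticeObservable Nf R) (B : QCDLatticeObservable Nf R'),
    ∃ (C δ : ℝ) (S₀ : ℕ), 0 < δ ∧ ∀ S : ℕ, S₀ ≤ S → ∀ n : ℕ, n ≤ S →
    ‖qcdLatticeConnectedCorr β (2 * S + 1) (fun _ : Fin Nf => μ) A B n‖ ≤ C * Real.exp (-(δ * n)))

/-- (U) statement. -/
def Stmt.stub_uniformlyMassiveAboveOfBody : Prop :=
    ∀ Nf : ℕ, Nf = 2 ∨ Nf = 3 → ∀ (reg : QCDRegularisation Nf) (M : ℝ), reg.HasMassScaling →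
    (reg.scheme 0 0 0).HasAsymptoticScaling →
    (∀ m : Fin Nf → ℝ, (∀ f, M < m f) → ∃ (z shift : QCDField Nf → ℕ → ℝ) (T : OSData (QCDField Nf) 4),
    IsQCDAlong (reg.scheme m z shift) T ∧ T.IsNontrivial QCDField.glue ∧ T.IsNonGaussian QCDField.glue ∧
    (∀ f g : Fin Nf, f ≠ g → T.IsNontrivial (QCDField.pseudoRe f g)) ∧
    ∃ Δ > 0, T.HasMassGap Δ ∧ (reg.scheme m z shift).HasLatticeMassGap Δ) →
    ∃ M' : ℝ, ∀ᶠ k in atTop, ∀ μ : ℝ, reg.mcrit k + reg.a k * M' / reg.Zm k ≤ μ →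
    ∀ (R R' : ℕ) (A : QCDLatticeObservable Nf R) (B : QCDLatticeObservable Nf R'), ∃ (C δ : ℝ) (S₀ : ℕ),
    0 < δ ∧ ∀ S : ℕ, S₀ ≤ S → ∀ n : ℕ, n ≤ S →
    ‖qcdLatticeConnectedCorr (reg.β k) (2 * S + 1) (fun _ : Fin Nf => μ) A B n‖ ≤ C * Real.exp (-(δ * n))

/-- (R) statement. -/
def Stmt.stub_nonMassiveBelowOfBody : Prop :=
    ∀ Nf : ℕ, Nf = 2 ∨ Nf = 3 → ∀ (reg : QCDRegularisation Nf) (M : ℝ), reg.HasMassScaling →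
    (reg.scheme 0 0 0).HasAsymptoticScaling →
    (∀ m : Fin Nf → ℝ, (∀ f, M < m f) → ∃ (z shift : QCDField Nf → ℕ → ℝ) (T : OSData (QCDField Nf) 4),
    IsQCDAlong (reg.scheme m z shift) T ∧ T.IsNontrivial QCDField.glue ∧ T.IsNonGaussian QCDField.glue ∧
    (∀ f g : Fin Nf, f ≠ g → T.IsNontrivial (QCDField.pseudoRe f g)) ∧
    ∃ Δ > 0, T.HasMassGap Δ ∧ (reg.scheme m z shift).HasLatticeMassGap Δ) →
    ∃ C : ℝ, ∀ᶠ k in atTop, ∃ μ : ℝ, reg.mcrit k - reg.a k * C / reg.Zm k ≤ μ ∧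
    ¬ (∀ (R R' : ℕ) (A : QCDLatticeObservable Nf R) (B : QCDLatticeObservable Nf R'), ∃ (C δ : ℝ) (S₀ : ℕ),
    0 < δ ∧ ∀ S : ℕ, S₀ ≤ S → ∀ n : ℕ, n ≤ S →
    ‖qcdLatticeConnectedCorr (reg.β k) (2 * S + 1) (fun _ : Fin Nf => μ) A B n‖ ≤ C * Real.exp (-(δ * n)))

/-! ## §1 The registered stubs (the ONLY `sorry`s of this file; statements fully inlined) -/

/-- (S1) the unpinned heavy-threshold anchor — VERBATIM `HeavyThresholdYMBridge.ThresholdQCD` (stmt-QuantumFields-8794): for `N_f ∈ {2,3}` some `M₀ ≥ 0` and ONE mass-scaling regularisation carrying the full heavy body above `M₀`. Open-problem (continuum SU(3) + heavy quarks, OS axioms, gap along an AF sequence); NECESSARY for the crux. -/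
theorem stub_heavyThresholdAnchor :
    ∀ Nf : ℕ, Nf = 2 ∨ Nf = 3 → ∃ M₀ : ℝ, 0 ≤ M₀ ∧ ∃ reg : QCDRegularisation Nf, reg.HasMassScaling ∧
    ∀ m : Fin Nf → ℝ, (∀ f, M₀ < m f) → ∃ (z shift : QCDField Nf → ℕ → ℝ) (T : OSData (QCDField Nf) 4),
    IsQCDAlong (reg.scheme m z shift) T ∧ T.IsNontrivial QCDField.glue ∧ T.IsNonGaussian QCDField.glue ∧
    (∀ f g : Fin Nf, f ≠ g → T.IsNontrivial (QCDField.pseudoRe f g)) ∧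
    ∃ Δ > 0, T.HasMassGap Δ ∧ (reg.scheme m z shift).HasLatticeMassGap Δ := by
  sorry

/-- (T) THE BRANCH TRANSITION (fixed coupling): for `N_f ∈ {2,3}` there is `β₀` such that at every `β ≥ β₀` SOME degenerate bare Wilson mass `μ > −1/2` is NON-massive for the `(−1)^F`-twisted odd-torus functional — a transition of the Wilson axis on the physical branch at fixed weak coupling (Aoki edge / Sharpe–Singleton coexistence). Open (unproved even at `β = 0` for Wilson fermions); the only stub not implied by the crux at its witness (the crux gives it along the witness's couplings with `−1 − ε` in place of `−1/2`). -/
theorem stub_branchTransition :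
    ∀ Nf : ℕ, Nf = 2 ∨ Nf = 3 → ∃ β₀ : ℝ, ∀ β : ℝ, β₀ ≤ β → ∃ μ : ℝ, -(1 / 2 : ℝ) < μ ∧
    ¬ (∀ (R R' : ℕ) (A : QCDLatticeObservable Nf R) (B : QCDLatticeObservable Nf R'),
    ∃ (C δ : ℝ) (S₀ : ℕ), 0 < δ ∧ ∀ S : ℕ, S₀ ≤ S → ∀ n : ℕ, n ≤ S →
    ‖qcdLatticeConnectedCorr β (2 * S + 1) (fun _ : Fin Nf => μ) A B n‖ ≤ C * Real.exp (-(δ * n))) := by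
  sorry

/-- (U) MASSIVE RAY ABOVE, for body-carrying regularisations: every mass-scaling, asymptotically scaling `reg` carrying the heavy body above `M` admits `M'` such that, eventually in `k`, EVERY degenerate bare mass `μ ≥ m_crit(k) + a_k M'/Z_m(k)` is massive at `β_k` (one onset for all such `μ` and all pairs): fixed-weak-`β_k` clustering of the anchor's own lattice theories uniformly in the RGI-heavy mass. Open; implied by the crux at its witness (`HonestHeavyAnchorLowerLocator.massive_rays_of_honestHeavyAnchor`). -/
theorem stub_uniformlyMassiveAboveOfBody :
    ∀ Nf : ℕ, Nf = 2 ∨ Nf = 3 → ∀ (reg : QCDRegularisation Nf) (M : ℝ), reg.HasMassScaling →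
    (reg.scheme 0 0 0).HasAsymptoticScaling →
    (∀ m : Fin Nf → ℝ, (∀ f, M < m f) → ∃ (z shift : QCDField Nf → ℕ → ℝ) (T : OSData (QCDField Nf) 4),
    IsQCDAlong (reg.scheme m z shift) T ∧ T.IsNontrivial QCDField.glue ∧ T.IsNonGaussian QCDField.glue ∧
    (∀ f g : Fin Nf, f ≠ g → T.IsNontrivial (QCDField.pseudoRe f g)) ∧
    ∃ Δ > 0, T.HasMassGap Δ ∧ (reg.scheme m z shift).HasLatticeMassGap Δ) →
    ∃ M' : ℝ, ∀ᶠ k in atTop, ∀ μ : ℝ, reg.mcrit k + reg.a k * M' / reg.Zm k ≤ μ →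
    ∀ (R R' : ℕ) (A : QCDLatticeObservable Nf R) (B : QCDLatticeObservable Nf R'), ∃ (C δ : ℝ) (S₀ : ℕ),
    0 < δ ∧ ∀ S : ℕ, S₀ ≤ S → ∀ n : ℕ, n ≤ S →
    ‖qcdLatticeConnectedCorr (reg.β k) (2 * S + 1) (fun _ : Fin Nf => μ) A B n‖ ≤ C * Real.exp (-(δ * n)) := by
  sorry

/-- (R) NON-MASSIVE POINT BELOW, for body-carrying regularisations: every such `reg` admits `C` such that, eventually in `k`, SOME degenerate bare mass `μ ≥ m_crit(k) − a_k C/Z_m(k)` is non-massive at `β_k` — the construction's critical mass sits within bounded RGI depth above a transition of its own lattice theories (the corner-free content of the upper locator: non-decoupling). Open (core: corner-relative renormalised decay rate, barrier `VafaWittenEigenvalueBound`; or the θ = π / PCAC-sign-flip certificates of Ideas/theta-pi-pinch.md, Ideas/pcac-sign-flip.md); implied by the crux at its witness (`HonestHeavyAnchorRaySplit.nonMassive_below_of_honestHeavyAnchor`). -/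
theorem stub_nonMassiveBelowOfBody :
    ∀ Nf : ℕ, Nf = 2 ∨ Nf = 3 → ∀ (reg : QCDRegularisation Nf) (M : ℝ), reg.HasMassScaling →
    (reg.scheme 0 0 0).HasAsymptoticScaling →
    (∀ m : Fin Nf → ℝ, (∀ f, M < m f) → ∃ (z shift : QCDField Nf → ℕ → ℝ) (T : OSData (QCDField Nf) 4),
    IsQCDAlong (reg.scheme m z shift) T ∧ T.IsNontrivial QCDField.glue ∧ T.IsNonGaussian QCDField.glue ∧
    (∀ f g : Fin Nf, f ≠ g → T.IsNontrivial (QCDField.pseudoRe f g)) ∧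
    ∃ Δ > 0, T.HasMassGap Δ ∧ (reg.scheme m z shift).HasLatticeMassGap Δ) →
    ∃ C : ℝ, ∀ᶠ k in atTop, ∃ μ : ℝ, reg.mcrit k - reg.a k * C / reg.Zm k ≤ μ ∧
    ¬ (∀ (R R' : ℕ) (A : QCDLatticeObservable Nf R) (B : QCDLatticeObservable Nf R'), ∃ (C δ : ℝ) (S₀ : ℕ),
    0 < δ ∧ ∀ S : ℕ, S₀ ≤ S → ∀ n : ℕ, n ≤ S →
    ‖qcdLatticeConnectedCorr (reg.β k) (2 * S + 1) (fun _ : Fin Nf => μ) A B n‖ ≤ C * Real.exp (-(δ * n))) := by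
  sorry

/-! ## §2 Composition (no `sorry` below): the crux BY NAME from the four stubs, over the landed ray-split glue -/

/-- **THE CRUX FROM THE FOUR STUBS OF REV 3** — `S1 → T → U → R → HonestHeavyAnchor`, by the landed
`HonestHeavyAnchorRaySplit.honestHeavyAnchor_of_threshold_of_branchTransition_of_rays`. [folklore] -/
theorem HonestHeavyAnchor_of :
    Stmt.stub_heavyThresholdAnchor → Stmt.stub_branchTransition → Stmt.stub_uniformlyMassiveAboveOfBody →
      Stmt.stub_nonMassiveBelowOfBody → HonestHeavyAnchor :=
  fun hA hT hU hR => HonestHeavyAnchorRaySplit.honestHeavyAnchor_of_threshold_of_branchTransition_of_rays hA hT hU hR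

/-- The crux along this skeleton, from the four registered stubs (sorries only inside `stub_*`). -/
theorem honestHeavyAnchor_of_stubs : HonestHeavyAnchor :=
  HonestHeavyAnchor_of stub_heavyThresholdAnchor stub_branchTransition stub_uniformlyMassiveAboveOfBody
    stub_nonMassiveBelowOfBody

end Summit.QuantumFields.QCD.Cruxes.HonestHeavyAnchor.BoundedLocator

end
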